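import Literature.AnabelianGeometry.SemiGraphs.BTempQDPairHomHatWC
import Literature.AnabelianGeometry.SemiGraphs.BTempQDPairHomHatComp
import HarnessLib

/-!
# Semi-graphs of anabelioids, Appendix, proof of Theorem A.4: the realisation of arrows by 1-proper
# covers, and hence `Hom^ ⥲ Hom_T` and `P ⥲ T⁰`, for `B^temp(Π)` over ANY topological group `Π`

Mochizuki, *Semi-graphs of anabelioids*, Publ. RIMS **42** (2006) 221–322, Appendix, proof of
Theorem A.4, manuscript pp. 83–85 (PRIMS p. 313 l. 23 – p. 315 l. 12)
[cite: MochizukiSemiAnbd2006, Thm A.4 proof pp.83-84]: "every element of `Hom_{T_i}(B/Γ_B, C/Γ_C)`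
arises from some morphism of strongly connected QD-pairs `(B′, Γ_B′) → (C, Γ_C)` where
`(B′, Γ_B′) → (B, Γ_B)` is a 1-proper morphism … `Hom_{T_i}(B/Γ_B, C/Γ_C)` may be reconstructed as the
… inductive limit `Hom^((B, Γ_B), (C, Γ_C))` … the third functor is the equivalence `P_i ⥲ T_i`".

PROOF-ONLY follow-up (seat abc-iut-w4-d048; no definitions) to abc-iut-w5-d129's
`BTempQDPairRealisation.lean` (`QDPair.homHatRealised_of_isStronglyConnected (hG : IsTempered Π)`),
as invited by the sub-DAG holder's collision ruling (2026-08-26T01:52Z, (b)): the ONLY use of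
`IsTempered Π` there is the 0-properness of the cover `B′ → B` via Rmk. A.3.1; abc-iut-w5-d220's
`QDPair.isZeroProper_of_surjective` (`BTempQDPairZeroProper.lean`) gives it for every topological
group, so — reusing d129's construction `QDPair.Realise.src/toB/toC/exists_lift/isQuotient_stabilizer`
verbatim, nothing rebuilt —

* `QDPair.Realise.isOneProper_toB'`, **`QDPair.homHatRealised_of_isStronglyConnected'`**,
  `homHatToHom_surjective'`, **`homHatToHom_bijective'`** / `homHatReconstructs'`: for `(B, Γ_B)`
  strongly connected and `(C, Γ_C)` arbitrary, `Hom^((B, Γ_B), (C, Γ_C)) ⥲ Hom_T(B/Γ_B, C/Γ_C)` for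
  `Π` ANY topological group (injectivity is abc-iut-w4-d081's `homHatToHom_injective`);
* the weakly connected case without temperedness: `HomHat.anchor_bijective'`,
  **`HomHatWC.toHom_bijective'`** (`BTempQDPairHomHatWC.lean`);
* the category of abc-iut-w4-d081 (`BTempQDPairCategoryP.lean`): `PCore.full_toT'`,
  **`PCore.isEquivalence_toT₀'`** — `P ⥲ T⁰` for every composition law `κ` (e.g. abc-iut-w5-d220's
  parameter-free `HomHatCompLaw.intrinsic`) and every topological group `Π`.

In [SemiAnbd] `Π` is tempered throughout, so these are harmless generalisations of the printed
statements (the same proofs, one hypothesis fewer); the unprimed tempered versions remain the decls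
of record.  Elementary; nothing refers to the IUT corpus; no side is taken on any disputed claim.
-/

open CategoryTheory

namespace Literature.AnabelianGeometry.SemiGraphs

universe u

namespace QDPair

variable {G : Type u} [Group G] [TopologicalSpace G] [IsTopologicalGroup G]

/-! ### The cover `B′ → B` is 1-proper with no hypothesis on `Π` -/

namespace Realise

variable {P C : QDPair (BTemp G)} (u : P.orbitQuotient ⟶ C.orbitQuotient)

/-- **`B′ → B` is 1-proper** for every topological group `Π`: 0-proper because surjective on points
(`isZeroProper_of_surjective`), lifting and quotient clauses as in `BTempQDPairRealisation.lean`.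
[cite: MochizukiSemiAnbd2006, Thm A.4 proof pp.83-84] -/
theorem isOneProper_toB' (hP : P.IsStronglyConnected) : Hom.IsOneProper (toB u hP) :=
  ⟨isZeroProper_of_surjective _ (toB_surjective u hP), exists_lift u hP, isQuotient_stabilizer u hP⟩

/-- The cover attached to `u` realises `u`: `(q(B′ → B))⁻¹ ≫ q(B′ → C) = u`, for every topological
group `Π`. [cite: MochizukiSemiAnbd2006, Thm A.4 proof pp.83-84] -/
theorem toHom_cover' (hP : P.IsStronglyConnected) :
    (⟨src u hP, toB u hP, BTemp.orbitObj_isConnectedObj _ _, isOneProper_toB' u hP⟩ :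
        OneProperCover P).toHom (homBarMk (toC u hP)) = u := by
  rw [OneProperCover.toHom_mk]
  haveI := isIso_orbitQuotientMap_of_isOneProper (toB u hP) (isOneProper_toB' u hP)
  change inv (orbitQuotientMap (toB u hP)) ≫ orbitQuotientMap (toC u hP) = u
  rw [IsIso.inv_comp_eq, orbitQuotientMap_toC]

end Realise

/-- **Row A4-S (realisation) for every topological group `Π`**: `QDPair.HomHatRealised P C` for
`(B, Γ_B)` strongly connected, `(C, Γ_C)` arbitrary. [cite: MochizukiSemiAnbd2006, Thm A.4 proof pp.83-84] -/
theorem homHatRealised_of_isStronglyConnected' {P : QDPair (BTemp G)} (C : QDPair (BTemp G))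
    (hP : P.IsStronglyConnected) : HomHatRealised P C := fun u =>
  ⟨⟨Realise.src u hP, Realise.toB u hP, BTemp.orbitObj_isConnectedObj _ _,
    Realise.isOneProper_toB' u hP⟩, Realise.toC u hP, Realise.toHom_cover' u hP⟩

/-- `Hom^ → Hom_T(B/Γ_B, C/Γ_C)` is surjective for `(B, Γ_B)` strongly connected (any `Π`).
[cite: MochizukiSemiAnbd2006, Thm A.4 proof p.84] -/
theorem homHatToHom_surjective' {P : QDPair (BTemp G)} (C : QDPair (BTemp G))
    (hP : P.IsStronglyConnected) : Function.Surjective (homHatToHom P C) :=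
  homHatToHom_surjective_of_realised (homHatRealised_of_isStronglyConnected' C hP)

/-- **`Hom^((B, Γ_B), (C, Γ_C)) ⥲ Hom_T(B/Γ_B, C/Γ_C)`** for `(B, Γ_B)` strongly connected, `Π` ANY
topological group. [cite: MochizukiSemiAnbd2006, Thm A.4 proof p.84] -/
theorem homHatToHom_bijective' {P : QDPair (BTemp G)} (C : QDPair (BTemp G))
    (hP : P.IsStronglyConnected) : Function.Bijective (homHatToHom P C) :=
  ⟨homHatToHom_injective P C, homHatToHom_surjective' C hP⟩

/-- The reconstruction predicate of `BTempQDPairHomHat.lean`, for every topological group.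
[cite: MochizukiSemiAnbd2006, Thm A.4 proof p.84] -/
theorem homHatReconstructs' {P : QDPair (BTemp G)} (C : QDPair (BTemp G)) (hP : P.IsStronglyConnected) :
    HomHatReconstructs P C :=
  homHatToHom_bijective' C hP

/-! ### The weakly connected case without temperedness -/

/-- The anchor `Hom^((B′, Γ_B′), (C′, Γ_C′)) → Hom_T(q(B, Γ_B), q(C, Γ_C))` is a bijection for
`(B, Γ_B)`, `(C, Γ_C)` weakly connected, `Π` any topological group. [cite: MochizukiSemiAnbd2006, Thm A.4 proof p.84] -/
theorem HomHat.anchor_bijective' {P C : QDPair (BTemp G)} (hP : P.IsWeaklyConnected)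
    (hC : C.IsWeaklyConnected) (b : P.A.obj.V) (c : C.A.obj.V) :
    Function.Bijective (HomHat.anchor hP b c (C := C)) := by
  refine ⟨HomHat.anchor_injective hP hC b c, fun u => ?_⟩
  haveI := C.isIso_orbitQuotientMap_componentIncl c hC
  obtain ⟨x, hx⟩ := homHatToHom_surjective' (C.componentPair c)
    (P.componentPair_isStronglyConnected b)
    ((P.componentQuotientIso b hP).hom ≫ u ≫ inv (orbitQuotientMap (C.componentIncl c)))
  refine ⟨x, ?_⟩
  unfold HomHat.anchor
  rw [hx]
  simp only [Category.assoc, IsIso.inv_hom_id, Category.comp_id, Iso.inv_hom_id_assoc]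

/-- **`Hom^((B, Γ_B), (C, Γ_C)) ⥲ Hom_T(q(B, Γ_B), q(C, Γ_C))`** for weakly connected QD-pairs of
`B^temp(Π)`, `Π` ANY topological group. [cite: MochizukiSemiAnbd2006, Thm A.4 proof p.84] -/
theorem HomHatWC.toHom_bijective' {P C : QDPair (BTemp G)} (hP : P.IsWeaklyConnected)
    (hC : C.IsWeaklyConnected) (b : P.A.obj.V) (c : C.A.obj.V) :
    Function.Bijective (HomHatWC.toHom hP b c : HomHatWC P C → _) :=
  (HomHat.anchor_bijective' hP hC b c).comp (HomHatWC.proj_bijective hP hC b c)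

/-! ### `P ⥲ T⁰` without temperedness -/

namespace PCore

variable (κ : HomHatCompLaw G)

/-- `P → T` is full for every topological group `Π`. [cite: MochizukiSemiAnbd2006, Thm A.4 proof p.85] -/
theorem full_toT' : (toT κ).Full :=
  ⟨fun {P C} => homHatToHom_surjective' C.pair P.isStronglyConnected⟩

/-- `P → T⁰` is full for every topological group `Π`. [cite: MochizukiSemiAnbd2006, Thm A.4 proof p.85] -/
theorem full_toT₀' : (toT₀ κ).Full := by
  haveI := full_toT' κ
  unfold toT₀; infer_instance

/-- **"the third functor is the equivalence `P_i ⥲ T_i`"** on the strongly connected core, for EVERY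
topological group `Π` and every (`q`-compatible, hence unique) composition law `κ`: `P → T⁰` is an
equivalence of categories. [cite: MochizukiSemiAnbd2006, Thm A.4 proof p.85] -/
theorem isEquivalence_toT₀' : (toT₀ κ).IsEquivalence :=
  { faithful := faithful_toT₀ κ, full := full_toT₀' κ, essSurj := essSurj_toT₀ κ }

/-- In particular for the parameter-free intrinsic law of `BTempQDPairHomHatComp.lean`.
[cite: MochizukiSemiAnbd2006, Thm A.4 proof p.85] -/
theorem isEquivalence_toT₀_intrinsic :
    (toT₀ (HomHatCompLaw.intrinsic (G := G))).IsEquivalence :=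
  isEquivalence_toT₀' _

end PCore

end QDPair

end Literature.AnabelianGeometry.SemiGraphs
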